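import Summits.RiemannHypothesis.RiemannHypothesis.Theses.WeilComb
import Summits.RiemannHypothesis.RiemannHypothesis.Theorems.WeilCombCombSubcriticalStubAutocorrelation
import Summits.RiemannHypothesis.RiemannHypothesis.Theorems.WeilCombCombSubcriticalStubPolar
import Summits.RiemannHypothesis.RiemannHypothesis.Theorems.WeilCombCombSubcriticalStubPrime
import Summits.RiemannHypothesis.RiemannHypothesis.Theorems.WeilCombCombSubcriticalStubArch
import HarnessLib.Audit

/-!
# Line `boosted-perron-supersolution` — skeleton for crux `WeilComb.CombSubcritical` ("Theorem A")
(item stmt-RiemannHypothesis-1025, route route-RiemannHypothesis-WeilComb; crux-plan, round 1)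

Idea card: `Cruxes/CombSubcritical/Ideas/boosted-perron-supersolution.md` (triage r1-2, r1-3: **pass**, counted
as ONE line with `perron-supersolution-core` — same lever).

## The line in one paragraph

The analytic half of the crux is LANDED (`Theorems.WeilCombSubcritical.stub_autocorrelation/_polar/_prime/_arch`,
p75293/p75696/p76011/p76634): for a Weil test `φ` supported in `[-1,1]`, `0 < ε`, `M ≥ 1`, `8εM ≤ 1`,
`Re Q(comb) ≥ ε⁻¹‖φ‖₂²·[(log(1/ε) − C)‖a‖² − H(a) − ε·archShadow(a)]` with an absolute `C`, where
`H(a) = ⟨S_M a, a⟩` is the von Mangoldt Helson form and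
`archShadow(a) = 5·A₋A₊ + 2·B_abs + 2·A₁²` (`A₋ = Σ‖a_m‖m^{-1/2}`, `A₊ = Σ‖a_m‖m^{1/2}`,
`B_abs = Σ_{m≠m'}‖a_m‖‖a_{m'}‖/|log m − log m'|`, `A₁ = Σ‖a_m‖`) — reproduced below as `analyticReduction`,
sorry-free.  What is left is the MATRIX SIDE: one entrywise-nonnegative symmetric majorant
`N = S_M + (c₁/M)·(5·P + 2·B + 2·J)` of `H + (c₁/M)·archShadow` acting on `|a|`
(`P[m,m'] = (√(m/m') + √(m'/m))/2` symmetrises the pole shadow `A₋A₊`, `B = 1/|log(m/m')|`, `J = 1`), whose Perron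
root this line bounds by the Schur / Collatz–Wielandt test `⟨N b, b⟩ ≤ Σ_m [(N w)_m / w_m]·b_m²` with the
BOOSTED Perron weight `w_m = m^{-1/2}·(1 − κ m/M)^{-1}` (κ = 1/2).  The von Mangoldt row of `S_M` splits into
MULTIPLES (`Σ_{n≤M/m} Λ(n)/n`, inflated by the boost by an absolute constant, Chebyshev) and DIVISORS
(`Σ_{d∣m} Λ(d) = log m`, discounted UNIFORMLY by `(1 − κx)/(1 − κx/2)`, `x = m/M`), so the row quotient is
`≤ log M − (κx/2)·log m + O(1)` (`stub_boostedRows`, the lever); the saving `(κx/2)·log m` at the top rows is exactly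
the currency in which the archimedean rows `(c₁/M)·(2·R^w_m + 5·P-row + 2·J-row) ≍ c₁·x·log m + O(c₁)`
(`stub_shadowRows`) are charged, whence `H(a) + (1/(200M))·archShadow(a) ≤ (log M + 10)‖a‖²`
(`stub_majorant`, the TRANSFER `C⁺`, explicit window `c₁ = 1/200`).  The glue
(`c₀ = min(1/200, e^{−(10 + C)})`; `εM ≤ c₀ ⇒ 8εM ≤ 1`, `ε·archShadow ≤ archShadow/(200M)`,
`log(1/ε) ≥ log M + 10 + C`; `M = 0` is `Q(0) = 0`) is PROVED below in `CombSubcritical_of`, which concludes the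
crux BY NAME.

Dictionary (verbatim expansions, no local `def`, so that every stub lands as a pure proof):
* `H M a`          ↦ `2 * (∑ m ∈ Icc 1 M, ∑ n ∈ Icc 1 (M / m), Λ(n)/√n · a (n m) · conj (a m)).re`
* `L M a`          ↦ `∑ m ∈ Icc 1 M, ‖a m‖ ^ 2`
* `w κ M k`        ↦ `1 / (√k · (1 − κ·k/M))` (boosted Perron weight; `0 ≤ κ < 1`)
* `archShadow M a` ↦ `5·(Σ ‖a m‖/√m)·(Σ ‖a m‖·√m) + 2·Σ_m Σ_{m'≠m} ‖a m‖‖a m'‖/|log m − log m'| + 2·(Σ ‖a m‖)²`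

Registered stubs: `stub_helsonSchur`, `stub_boostedRows`, `stub_shadowRows`, `stub_majorant` (4).
-/

noncomputable section

open scoped BigOperators ComplexConjugate
open Complex MeasureTheory Set

namespace Summit.RiemannHypothesis.RiemannHypothesis.Cruxes.CombSubcritical.BoostedPerronSupersolution

open Literature.NumberTheory.LFunctions

/-! ### The registered stubs (signatures over existing declarations only) -/

/-- **Stub 1 — weighted Schur test for the von Mangoldt Helson form** (generic positive weight `w`).
For every `M`, every `a : ℕ → ℂ` and every weight `w` positive on `[1, M]`:
`⟨S_M a, a⟩ ≤ Σ_{m≤M} ‖a_m‖²·[(Σ_{n≤M/m} Λ(n) n^{-1/2} w(nm) + Σ_{d∣m} Λ(d) d^{-1/2} w(m/d)) / w(m)]`.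
Proof sketch: `2 Re(c·a_{nm}·conj a_m) ≤ c·(t‖a_{nm}‖² + ‖a_m‖²/t)` with `c = Λ(n)n^{-1/2} ≥ 0`,
`t = w(m)/w(nm) > 0`; the `‖a_m‖²` half is the multiples row; the `‖a_{nm}‖²` half, re-indexed over
`k = nm ≤ M`, `d = n ∣ k`, is the divisor row (as in the landed `stub_identity`).  With `w(m) = m^{-1/2}` and
Mertens this is the route's `CombHelsonBound`. -/
theorem stub_helsonSchur :
    ∀ (M : ℕ) (a : ℕ → ℂ) (w : ℕ → ℝ), (∀ m ∈ Finset.Icc 1 M, 0 < w m) →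
      2 * (∑ m ∈ Finset.Icc 1 M, ∑ n ∈ Finset.Icc 1 (M / m),
          ((ArithmeticFunction.vonMangoldt n : ℝ) : ℂ) / (Real.sqrt n : ℂ) * a (n * m) *
            conj (a m)).re ≤
        ∑ m ∈ Finset.Icc 1 M, ‖a m‖ ^ 2 *
          (((∑ n ∈ Finset.Icc 1 (M / m),
              (ArithmeticFunction.vonMangoldt n : ℝ) / Real.sqrt n * w (n * m)) +
            ∑ d ∈ Nat.divisors m,
              (ArithmeticFunction.vonMangoldt d : ℝ) / Real.sqrt d * w (m / d)) / w m) := by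
  sorry

/-- **Stub 2 — the boosted supersolution rows (the LEVER).**  For `0 ≤ κ < 1`, `1 ≤ m ≤ M`, `x = m/M`,
the row quotient `(S_M w)_m / w_m` of the boosted weight `w_k = k^{-1/2}(1 − κk/M)^{-1}`, written out
(`Λ(n)n^{-1/2}w(nm)/w(m) = (Λ(n)/n)·(1−κx)/(1−κnx)`, `Λ(d)d^{-1/2}w(m/d)/w(m) = Λ(d)·(1−κx)/(1−κ(m/d)/M)`),
plus the ramp `(κ/2)·x·log m`, is at most `log M + 1 + 6κ/(1−κ)`.
Proof sketch: MULTIPLES `(1−κx)/(1−κnx) = 1 + κx(n−1)/(1−κnx) ≤ 1 + κnx/(1−κ)` (`nm ≤ M`), so the first sum is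
`≤ Σ_{n≤M/m}Λ(n)/n + (κx/(1−κ))·ψ(M/m) ≤ log(M/m) + 1 + (log 4 + 4)κ/(1−κ)`
(`sum_vonMangoldt_div_lt_log_add_one`, `sum_Icc_vonMangoldt_le`); DIVISORS: for `d ≥ 2`,
`(1−κx)/(1−κx/d) ≤ (1−κx)/(1−κx/2) = 1 − (κx/2)/(1−κx/2) ≤ 1 − κx/2`, and `Σ_{d∣m}Λ(d) = log m`
(`ArithmeticFunction.vonMangoldt_sum`), so the second sum is `≤ log m − (κx/2)·log m`.  Total
`≤ log M + 1 + 5.39κ/(1−κ) − (κx/2) log m`.  Numerics (kit j010224 / triage j010689 E, exact rows): at κ = ½ the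
true value of `max_m LHS − log M` is `+0.20` (ramp `x log m/4`; exact rows, `M ≤ 1.2·10⁴`, this seat's `kit/check_rows.py`)
and `+0.175` with ramp `x log m/8`, flat for `M = 10³…10⁶`. -/
theorem stub_boostedRows :
    ∀ κ : ℝ, 0 ≤ κ → κ < 1 → ∀ M m : ℕ, 1 ≤ m → m ≤ M →
      (∑ n ∈ Finset.Icc 1 (M / m),
          (ArithmeticFunction.vonMangoldt n : ℝ) / n *
            ((1 - κ * ((m : ℝ) / M)) / (1 - κ * (((n * m : ℕ) : ℝ) / M)))) +
        (∑ d ∈ Nat.divisors m,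
          (ArithmeticFunction.vonMangoldt d : ℝ) *
            ((1 - κ * ((m : ℝ) / M)) / (1 - κ * (((m / d : ℕ) : ℝ) / M)))) +
        κ / 2 * ((m : ℝ) / M) * Real.log m
      ≤ Real.log M + 1 + 6 * κ / (1 - κ) := by
  sorry

/-- **Stub 3 — boosted-weight row sums of the three archimedean shadow kernels.**  For `0 ≤ κ < 1`,
`1 ≤ m ≤ M`, `w_k = 1/(√k·(1 − κk/M))`:
(beam)  `Σ_{m'≠m, m'≤M} w_{m'}/|log m − log m'| ≤ w_m·(7m(1 + log m) + 2M)/(1−κ)`;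
(pole)  `Σ_{m'≤M} [(√(m/m') + √(m'/m))/2]·w_{m'} ≤ w_m·(m(1 + log M) + M)/(2(1−κ))`;
(ones)  `Σ_{m'≤M} w_{m'} ≤ w_m·2M/(1−κ)`.
Proof sketch: `w_{m'}/w_m = √(m/m')·f(x')/f(x) ≤ √(m/m')/(1−κ)` (`1 ≤ f ≤ 1/(1−κ)`).  Beam:
`|log m − log m'| ≥ |m − m'|/max(m,m')` and `≥ log 2` when `m' ∉ (m/2, 2m)`; so `Σ_{m'≤m/2} ≤ √2·m/log 2`,
`Σ_{m/2<m'<m} ≤ √2·m·H_m`, `Σ_{m<m'≤2m} ≤ 2m·H_m`, `Σ_{m'>2m} ≤ 2√(mM)/log 2 ≤ (m + M)/log 2`, total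
`≤ 3.5m(1 + log m) + 3.5m + 1.5M` (cf. the landed `rowsum_le` in `WeilCombCombSubcriticalStubCore`:
`R_m ≤ 3m(1+log m) + 2M` unweighted).  Pole: `Σ_{m'} √(m/m')·√(m/m')f(x') ≤ m·H_M/(1−κ) ≤ m(1+log M)/(1−κ)`
(`harmonic_le_one_add_log`) and `Σ_{m'} 1·f(x') ≤ M/(1−κ)`; divide by `w_m = f(x)/√m ≥ 1/√m`.  Ones:
`Σ_{m'≤M} 1/√m' ≤ 2√M` and `√(mM) ≤ M`.  Numerics: `kit/check_rows.py` (this seat; exact sums, M ≤ 4000). -/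
theorem stub_shadowRows :
    ∀ κ : ℝ, 0 ≤ κ → κ < 1 → ∀ M m : ℕ, 1 ≤ m → m ≤ M →
      (∑ m' ∈ (Finset.Icc 1 M).erase m,
          1 / (Real.sqrt m' * (1 - κ * ((m' : ℝ) / M))) / |Real.log m - Real.log m'| ≤
        (7 * m * (1 + Real.log m) + 2 * M) / (1 - κ) *
          (1 / (Real.sqrt m * (1 - κ * ((m : ℝ) / M))))) ∧
      (∑ m' ∈ Finset.Icc 1 M,
          (Real.sqrt m / Real.sqrt m' + Real.sqrt m' / Real.sqrt m) / 2 *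
            (1 / (Real.sqrt m' * (1 - κ * ((m' : ℝ) / M)))) ≤
        ((m : ℝ) * (1 + Real.log M) + M) / (2 * (1 - κ)) *
          (1 / (Real.sqrt m * (1 - κ * ((m : ℝ) / M))))) ∧
      (∑ m' ∈ Finset.Icc 1 M, 1 / (Real.sqrt m' * (1 - κ * ((m' : ℝ) / M))) ≤
        2 * (M : ℝ) / (1 - κ) * (1 / (Real.sqrt m * (1 - κ * ((m : ℝ) / M))))) := by
  sorry

/-- **Stub 4 — the TRANSFER `C⁺` (boosted majorant bound, explicit window `c₁ = 1/200`).**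
From Stubs 1–3: for every `M ≥ 1` and every `a : ℕ → ℂ`,
`⟨S_M a,a⟩ + (1/(200M))·archShadow(a) ≤ (log M + 10)·‖a‖²`.
Proof sketch (κ = 1/2 throughout, `b = |a|`, `x = m/M`): `⟨S_M a,a⟩ ≤ Σ_m b_m²·q_m` with
`q_m ≤ log M + 7 − (x/4)·log m` (Stub 1 with the boosted weight, then Stub 2: the two written-out sums ARE the
bracket of Stub 1 divided by `w_m`); for each symmetric entrywise-nonnegative kernel `K ∈ {B, P, J}` the Schur test
`Σ_{m,m'} K b_m b_{m'} ≤ Σ_m b_m²·(Σ_{m'} K[m,m'] w_{m'})/w_m` (AM–GM `b_m b_{m'} ≤ ½(b_m² w_{m'}/w_m + b_{m'}² w_m/w_{m'})`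
and symmetry), where `A₋A₊ = Σ_{m,m'} b_m b_{m'} P[m,m']` after symmetrising `√(m'/m)`; Stub 3 prices the rows:
`(1/(200M))·[2·2(7m(1+log m) + 2M) + 5·(m(1+log M) + M) + 2·4M]`
`= (1/200)·[28x(1+log m) + 8 + 5x(1 + log M) + 5 + 8]`, and `x·log M ≤ x·log m + 1/e`; the coefficient of
`x·log m` is `33/200 − 1/4 < 0` (dropped), the constants add to `7 + 55.9/200 < 10`.  Numerics: the truth is
`λ_max(N) − log M ≈ −0.45` at `c₁ = 1/200`, `−0.39` at `1/66` (dense, M ≤ 3000, flat; kit j010224, triage j010857). -/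
theorem stub_majorant :
    (∀ (M : ℕ) (a : ℕ → ℂ) (w : ℕ → ℝ), (∀ m ∈ Finset.Icc 1 M, 0 < w m) →
      2 * (∑ m ∈ Finset.Icc 1 M, ∑ n ∈ Finset.Icc 1 (M / m),
          ((ArithmeticFunction.vonMangoldt n : ℝ) : ℂ) / (Real.sqrt n : ℂ) * a (n * m) *
            conj (a m)).re ≤
        ∑ m ∈ Finset.Icc 1 M, ‖a m‖ ^ 2 *
          (((∑ n ∈ Finset.Icc 1 (M / m),
              (ArithmeticFunction.vonMangoldt n : ℝ) / Real.sqrt n * w (n * m)) +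
            ∑ d ∈ Nat.divisors m,
              (ArithmeticFunction.vonMangoldt d : ℝ) / Real.sqrt d * w (m / d)) / w m)) →
    (∀ κ : ℝ, 0 ≤ κ → κ < 1 → ∀ M m : ℕ, 1 ≤ m → m ≤ M →
      (∑ n ∈ Finset.Icc 1 (M / m),
          (ArithmeticFunction.vonMangoldt n : ℝ) / n *
            ((1 - κ * ((m : ℝ) / M)) / (1 - κ * (((n * m : ℕ) : ℝ) / M)))) +
        (∑ d ∈ Nat.divisors m,
          (ArithmeticFunction.vonMangoldt d : ℝ) *
            ((1 - κ * ((m : ℝ) / M)) / (1 - κ * (((m / d : ℕ) : ℝ) / M)))) +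
        κ / 2 * ((m : ℝ) / M) * Real.log m
      ≤ Real.log M + 1 + 6 * κ / (1 - κ)) →
    (∀ κ : ℝ, 0 ≤ κ → κ < 1 → ∀ M m : ℕ, 1 ≤ m → m ≤ M →
      (∑ m' ∈ (Finset.Icc 1 M).erase m,
          1 / (Real.sqrt m' * (1 - κ * ((m' : ℝ) / M))) / |Real.log m - Real.log m'| ≤
        (7 * m * (1 + Real.log m) + 2 * M) / (1 - κ) *
          (1 / (Real.sqrt m * (1 - κ * ((m : ℝ) / M))))) ∧
      (∑ m' ∈ Finset.Icc 1 M,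
          (Real.sqrt m / Real.sqrt m' + Real.sqrt m' / Real.sqrt m) / 2 *
            (1 / (Real.sqrt m' * (1 - κ * ((m' : ℝ) / M)))) ≤
        ((m : ℝ) * (1 + Real.log M) + M) / (2 * (1 - κ)) *
          (1 / (Real.sqrt m * (1 - κ * ((m : ℝ) / M))))) ∧
      (∑ m' ∈ Finset.Icc 1 M, 1 / (Real.sqrt m' * (1 - κ * ((m' : ℝ) / M))) ≤
        2 * (M : ℝ) / (1 - κ) * (1 / (Real.sqrt m * (1 - κ * ((m : ℝ) / M)))))) →
    ∀ (M : ℕ) (a : ℕ → ℂ), 1 ≤ M →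
      2 * (∑ m ∈ Finset.Icc 1 M, ∑ n ∈ Finset.Icc 1 (M / m),
          ((ArithmeticFunction.vonMangoldt n : ℝ) : ℂ) / (Real.sqrt n : ℂ) * a (n * m) *
            conj (a m)).re +
        1 / (200 * M) * (5 * (∑ m ∈ Finset.Icc 1 M, ‖a m‖ / Real.sqrt m) *
              (∑ m ∈ Finset.Icc 1 M, ‖a m‖ * Real.sqrt m) +
            2 * (∑ m ∈ Finset.Icc 1 M, ∑ m' ∈ (Finset.Icc 1 M).erase m,
              ‖a m‖ * ‖a m'‖ / |Real.log m - Real.log m'|) +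
            2 * (∑ m ∈ Finset.Icc 1 M, ‖a m‖) ^ 2) ≤
      (Real.log M + 10) * ∑ m ∈ Finset.Icc 1 M, ‖a m‖ ^ 2 := by
  sorry

/-! ### The analytic half — LANDED (no sorry): `Re Q ≥ ε⁻¹‖φ‖₂²[(log(1/ε) − C)‖a‖² − H − ε·archShadow]` -/

/-- **The analytic reduction**, assembled from the LANDED theorems
`Theorems.WeilCombSubcritical.stub_autocorrelation` (p75293), `stub_polar` (p75696), `stub_prime` (p76011),
`stub_arch` (p76634): for a Weil test `φ` supported in `[-1,1]`, `0 < ε`, `M ≥ 1`, `8εM ≤ 1`,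
`Re Q(g) ≥ ε⁻¹‖φ‖₂²·[(log(1/ε) − C)‖a‖² − ⟨S_M a,a⟩ − ε·archShadow(a)]` with an ABSOLUTE `C`
(`Q(g) = W(g ⋆ g̃) = polar − prime + arch` by definition).  Proof = the lead's glue of line
`helson-dirichlet-slack` rev L2, now over theorems. -/
theorem analyticReduction :
    ∃ C : ℝ, ∀ φ : ℝ → ℂ, IsWeilTest φ → tsupport φ ⊆ Set.Icc (-1) 1 →
      ∀ ε : ℝ, 0 < ε → ∀ (M : ℕ) (a : ℕ → ℂ), 1 ≤ M → 8 * ε * M ≤ 1 →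
        ε⁻¹ * weilNorm2Sq φ *
            ((Real.log (1 / ε) - C) * (∑ m ∈ Finset.Icc 1 M, ‖a m‖ ^ 2) -
              2 * (∑ m ∈ Finset.Icc 1 M, ∑ n ∈ Finset.Icc 1 (M / m),
                ((ArithmeticFunction.vonMangoldt n : ℝ) : ℂ) / (Real.sqrt n : ℂ) * a (n * m) *
                  conj (a m)).re -
              ε * (5 * (∑ m ∈ Finset.Icc 1 M, ‖a m‖ / Real.sqrt m) *
                    (∑ m ∈ Finset.Icc 1 M, ‖a m‖ * Real.sqrt m) +
                  2 * (∑ m ∈ Finset.Icc 1 M, ∑ m' ∈ (Finset.Icc 1 M).erase m,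
                    ‖a m‖ * ‖a m'‖ / |Real.log m - Real.log m'|) +
                  2 * (∑ m ∈ Finset.Icc 1 M, ‖a m‖) ^ 2)) ≤
          (weilQuadratic (fun x : ℝ => ∑ m ∈ Finset.Icc 1 M,
            a m * ((ε : ℂ)⁻¹ * φ ((x - Real.log (m : ℝ)) / ε)))).re := by
  obtain ⟨C, hC⟩ :=
    _root_.Summit.RiemannHypothesis.RiemannHypothesis.Theorems.WeilCombSubcritical.stub_arch
      _root_.Summit.RiemannHypothesis.RiemannHypothesis.Theorems.WeilCombSubcritical.stub_autocorrelation
  refine ⟨C, fun φ hφ hsupp ε hε M a hM h8 => ?_⟩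
  have hMr : (1 : ℝ) ≤ (M : ℝ) := by exact_mod_cast hM
  have hε8 : ε ≤ 1 / 8 := by nlinarith
  have hP :=
    _root_.Summit.RiemannHypothesis.RiemannHypothesis.Theorems.WeilCombSubcritical.stub_polar
      φ hφ hsupp ε hε hε8 M a
  have hPr :=
    _root_.Summit.RiemannHypothesis.RiemannHypothesis.Theorems.WeilCombSubcritical.stub_prime
      _root_.Summit.RiemannHypothesis.RiemannHypothesis.Theorems.WeilCombSubcritical.stub_autocorrelation
      φ hφ hsupp ε hε M a hM h8
  have hA := hC φ hφ hsupp ε hε M a hM h8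
  -- names for the real atoms
  set N : ℝ := weilNorm2Sq φ with hN
  set H : ℝ := 2 * (∑ m ∈ Finset.Icc 1 M, ∑ n ∈ Finset.Icc 1 (M / m),
      ((ArithmeticFunction.vonMangoldt n : ℝ) : ℂ) / (Real.sqrt n : ℂ) * a (n * m) *
        conj (a m)).re with hH
  set L : ℝ := ∑ m ∈ Finset.Icc 1 M, ‖a m‖ ^ 2 with hL
  set Am : ℝ := ∑ m ∈ Finset.Icc 1 M, ‖a m‖ / Real.sqrt m with hAm
  set Ap : ℝ := ∑ m ∈ Finset.Icc 1 M, ‖a m‖ * Real.sqrt m with hAp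
  set B : ℝ := ∑ m ∈ Finset.Icc 1 M, ∑ m' ∈ (Finset.Icc 1 M).erase m,
      ‖a m‖ * ‖a m'‖ / |Real.log m - Real.log m'| with hB
  set A1 : ℝ := ∑ m ∈ Finset.Icc 1 M, ‖a m‖ with hA1
  set k : ℝ → ℂ := weilConv (fun x : ℝ => ∑ m ∈ Finset.Icc 1 M,
      a m * ((ε : ℂ)⁻¹ * φ ((x - Real.log (m : ℝ)) / ε)))
    (weilReflect (fun x : ℝ => ∑ m ∈ Finset.Icc 1 M,
      a m * ((ε : ℂ)⁻¹ * φ ((x - Real.log (m : ℝ)) / ε)))) with hk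
  have hQ : (weilQuadratic (fun x : ℝ => ∑ m ∈ Finset.Icc 1 M,
      a m * ((ε : ℂ)⁻¹ * φ ((x - Real.log (m : ℝ)) / ε)))).re =
      (weilPolarTerm k).re - (weilPrimeTerm k).re + (weilArchTerm k).re := by
    simp only [weilQuadratic, weilFunctional, hk, Complex.add_re, Complex.sub_re]
  rw [hQ, hPr, Complex.ofReal_re]
  have e : ε⁻¹ * N * ((Real.log (1 / ε) - C) * L - H - ε * (5 * Am * Ap + 2 * B + 2 * A1 ^ 2)) =
      ε⁻¹ * N * ((Real.log (1 / ε) - C) * L) - ε⁻¹ * N * H -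
        (5 * N * Am * Ap + 2 * N * (B + A1 ^ 2)) := by
    field_simp
    ring
  rw [e]
  linarith [hP, hA]

/-! ### The composition (concludes the crux BY NAME; sorry-free glue) -/

/-- **`CombSubcritical` from the stubs.**  The boosted majorant (Stubs 1, 2, 3 ⇒ `stub_majorant`, explicit
window `c₁ = 1/200`, constant `10`) and the landed analytic reduction (`analyticReduction`, absolute `C`) are glued
by bookkeeping: `c₀ := min (1/200) (exp (−(10 + C)))`; for `M ≥ 1`, `εM ≤ c₀` gives (i) `8εM ≤ 1` (exact prime
side), (ii) `ε ≤ 1/(200M)`, so `ε·archShadow ≤ archShadow/(200M)` is paid by the majorant, (iii) the budget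
`log(1/ε) ≥ log M + 10 + C`; hence `(log(1/ε) − C)‖a‖² − H − ε·archShadow ≥ (log M + 10)‖a‖² − H −
archShadow/(200M) ≥ 0`.  `M = 0` is `Q(0) = 0` (`weilQuadratic_zero`). -/
theorem CombSubcritical_of :
    Summit.RiemannHypothesis.RiemannHypothesis.Theses.WeilComb.CombSubcritical := by
  have hK := stub_majorant stub_helsonSchur stub_boostedRows stub_shadowRows
  obtain ⟨C, hC⟩ := analyticReduction
  refine ⟨min (1 / 200) (Real.exp (-(10 + C))), lt_min (by norm_num) (Real.exp_pos _), ?_⟩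
  intro φ hφ hsupp ε hε M a hεM
  rcases Nat.eq_zero_or_pos M with hM0 | hMpos
  · -- `M = 0`: the comb is the zero function and `Q(0) = 0`
    subst hM0
    have h0 : (fun x : ℝ => ∑ m ∈ Finset.Icc 1 0,
        a m * ((ε : ℂ)⁻¹ * φ ((x - Real.log (m : ℝ)) / ε))) = 0 := by
      funext x
      simp
    rw [h0, weilQuadratic_zero]
    simp
  · have hM1 : 1 ≤ M := hMpos
    have hMr : (1 : ℝ) ≤ (M : ℝ) := by exact_mod_cast hM1
    have hMpos' : (0 : ℝ) < (M : ℝ) := by linarith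
    have h200 : ε * M ≤ 1 / 200 := le_trans hεM (min_le_left _ _)
    have hexp : ε * M ≤ Real.exp (-(10 + C)) := le_trans hεM (min_le_right _ _)
    -- uses `ε·M ≤ c₀` (i): `8εM ≤ 8/200 ≤ 1`
    have h8 : 8 * ε * M ≤ 1 := by
      have e8 : 8 * ε * M = 8 * (ε * M) := by ring
      rw [e8]
      linarith
    have hR := hC φ hφ hsupp ε hε M a hM1 h8
    have hKM := hK M a hM1
    -- uses `ε·M ≤ c₀` (ii): `ε ≤ 1/(200 M)` pays the archimedean shadow
    have hεle : ε ≤ 1 / (200 * M) := by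
      rw [le_div_iff₀ (by positivity)]
      have e2 : ε * (200 * M) = 200 * (ε * M) := by ring
      rw [e2]
      linarith
    -- uses `ε·M ≤ c₀` (iii): the budget `log(1/ε) ≥ log M + 10 + C`
    have hlog : Real.log M + 10 + C ≤ Real.log (1 / ε) := by
      have h1 : (M : ℝ) * Real.exp (10 + C) ≤ 1 / ε := by
        rw [le_div_iff₀ hε]
        have hE : Real.exp (-(10 + C)) * Real.exp (10 + C) = 1 := by
          rw [← Real.exp_add]
          simp
        calc (M : ℝ) * Real.exp (10 + C) * ε = (ε * M) * Real.exp (10 + C) := by ring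
          _ ≤ Real.exp (-(10 + C)) * Real.exp (10 + C) :=
              mul_le_mul_of_nonneg_right hexp (Real.exp_pos _).le
          _ = 1 := hE
      have h2 : Real.log ((M : ℝ) * Real.exp (10 + C)) = Real.log M + (10 + C) := by
        rw [Real.log_mul hMpos'.ne' (Real.exp_pos _).ne', Real.log_exp]
      have h3 : Real.log ((M : ℝ) * Real.exp (10 + C)) ≤ Real.log (1 / ε) :=
        Real.log_le_log (by positivity) h1
      linarith
    -- names for the real atoms
    set H : ℝ := 2 * (∑ m ∈ Finset.Icc 1 M, ∑ n ∈ Finset.Icc 1 (M / m),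
          ((ArithmeticFunction.vonMangoldt n : ℝ) : ℂ) / (Real.sqrt n : ℂ) * a (n * m) *
            conj (a m)).re with hH
    set L : ℝ := ∑ m ∈ Finset.Icc 1 M, ‖a m‖ ^ 2 with hL
    set S : ℝ := 5 * (∑ m ∈ Finset.Icc 1 M, ‖a m‖ / Real.sqrt m) *
              (∑ m ∈ Finset.Icc 1 M, ‖a m‖ * Real.sqrt m) +
            2 * (∑ m ∈ Finset.Icc 1 M, ∑ m' ∈ (Finset.Icc 1 M).erase m,
              ‖a m‖ * ‖a m'‖ / |Real.log m - Real.log m'|) +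
            2 * (∑ m ∈ Finset.Icc 1 M, ‖a m‖) ^ 2 with hS
    have hS0 : 0 ≤ S := by
      have h1 : 0 ≤ ∑ m ∈ Finset.Icc 1 M, ‖a m‖ / Real.sqrt m :=
        Finset.sum_nonneg fun _ _ => by positivity
      have h2 : 0 ≤ ∑ m ∈ Finset.Icc 1 M, ‖a m‖ * Real.sqrt m :=
        Finset.sum_nonneg fun _ _ => by positivity
      have h3 : 0 ≤ ∑ m ∈ Finset.Icc 1 M, ∑ m' ∈ (Finset.Icc 1 M).erase m,
          ‖a m‖ * ‖a m'‖ / |Real.log m - Real.log m'| :=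
        Finset.sum_nonneg fun _ _ => Finset.sum_nonneg fun _ _ => by positivity
      have h4 : 0 ≤ (∑ m ∈ Finset.Icc 1 M, ‖a m‖) ^ 2 := sq_nonneg _
      rw [hS]
      nlinarith [mul_nonneg h1 h2]
    have hL0 : 0 ≤ L := Finset.sum_nonneg fun _ _ => by positivity
    have hX : 0 ≤ (Real.log (1 / ε) - C) * L - H - ε * S := by
      have h1 : ε * S ≤ 1 / (200 * M) * S := mul_le_mul_of_nonneg_right hεle hS0
      have h2 : (Real.log M + 10) * L ≤ (Real.log (1 / ε) - C) * L :=
        mul_le_mul_of_nonneg_right (by linarith) hL0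
      linarith [hKM, h1, h2]
    have hpref : 0 ≤ ε⁻¹ * weilNorm2Sq φ :=
      mul_nonneg (inv_nonneg.2 hε.le) (weilNorm2Sq_nonneg φ)
    exact le_trans (mul_nonneg hpref hX) hR

end Summit.RiemannHypothesis.RiemannHypothesis.Cruxes.CombSubcritical.BoostedPerronSupersolution

end

#h21_check_skeleton "stmt-RiemannHypothesis-1025" Summit.RiemannHypothesis.RiemannHypothesis.Theses.WeilComb.CombSubcritical stub_helsonSchur stub_boostedRows stub_shadowRows stub_majorant
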